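import Mathlib
import Summits.Ventures.PercRepro2.TwoSumCap2Count

/-!
# The capacitated counts of a doubled base assemble into its genuine pattern counts
(seat mine-b, cell pub-perc-repro2; conjectures/MINE-B.md §13.3)

For a base `A₁` with a parallel pair `p₁, p₂` and a pattern `(O₁, Y₁)` avoiding the pair, the
capacitated counts `capH a b` (TwoSumCap2Count.lean: `a` copies for red, `b` for blue) are the
genuine pattern counts of the doubled base: `capH 0 0 = H(del)`, `capH 1 0 + capH 0 1 = H(p₁ split)`,
`capH 1 1 = H(p₁ pinned)`, `capH 2 0 + capH 0 2 + 2·capH 1 1 = H(both split)` (the two mixed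
colourings of the pair are the pinned pattern, by the swap), `capH 2 1 + capH 1 2 = H(p₁ pinned,
p₂ split)`, `capH 2 2 = H(both pinned)`.  These feed the absorption lemma in TwoSumStep2.lean.
-/

open Finset

namespace Summit.Ventures.PercRepro2

namespace StepZero

open ReimerCube

variable {E₁ E₂ : Type*} [DecidableEq E₁]

section Identities

variable {A₁ : Finset E₁ → Prop} {p₁ p₂ : E₁}

open Classical

/-- `S ∪ {p} = insert p S` -/
lemma union_singleton_eq_insert (S : Finset E₁) (p : E₁) : S ∪ {p} = insert p S := by
  rw [Finset.insert_eq, Finset.union_comm]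

/-- `S ∪ {p₁, p₂} = insert p₁ (insert p₂ S)` -/
lemma union_pair_eq_insert (S : Finset E₁) (p₁ p₂ : E₁) :
    S ∪ {p₁, p₂} = insert p₁ (insert p₂ S) := by
  ext x; simp only [Finset.mem_union, Finset.mem_insert, Finset.mem_singleton]; tauto

/-- the swap exchanges the two single copies on a configuration avoiding the pair -/
lemma kDisj_insert_swap (hpar : IsParallel A₁ p₁ p₂) (k : ℕ) {S : Finset E₁} (h1 : p₁ ∉ S)
    (h2 : p₂ ∉ S) : kDisj A₁ k (insert p₂ S) ↔ kDisj A₁ k (insert p₁ S) := by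
  constructor
  · intro h
    apply kDisj_image_swap₂ hpar k
    rw [image_swap₂_insert p₁ p₂ h1 h2]; exact h
  · intro h
    apply kDisj_image_swap₂ hpar k
    rw [image_swap₂_insert' p₁ p₂ hpar.ne h1 h2]; exact h

/-- `capH 0 0` is the deleted pattern -/
lemma capH_zero_zero (O₁ Y₁ : Finset E₁) (i j : ℕ) :
    capH A₁ p₁ p₂ O₁ Y₁ i j 0 0 = absH A₁ O₁ Y₁ i j := by
  unfold capH absH pinK
  simp [cp]

/-- `capH 1 1` is the pattern with one copy pinned -/
lemma capH_one_one (O₁ Y₁ : Finset E₁) (i j : ℕ) :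
    capH A₁ p₁ p₂ O₁ Y₁ i j 1 1 = absH A₁ (insert p₁ O₁) Y₁ i j := by
  unfold capH absH pinK
  simp only [cp]
  congr 1
  ext γ₁
  rw [Finset.mem_filter, Finset.mem_filter]
  apply and_congr_right
  intro _
  rw [union_union_singleton_eq, union_union_singleton_eq]

/-- `capH 2 2` is the pattern with both copies pinned -/
lemma capH_two_two (O₁ Y₁ : Finset E₁) (i j : ℕ) :
    capH A₁ p₁ p₂ O₁ Y₁ i j 2 2 = absH A₁ (insert p₁ (insert p₂ O₁)) Y₁ i j := by
  unfold capH absH pinK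
  simp only [cp]
  congr 1
  ext γ₁
  rw [Finset.mem_filter, Finset.mem_filter]
  apply and_congr_right
  intro _
  have e : ∀ S : Finset E₁, O₁ ∪ S ∪ {p₁, p₂} = insert p₁ (insert p₂ O₁) ∪ S := by
    intro S; ext x
    simp only [Finset.mem_union, Finset.mem_insert, Finset.mem_singleton]; tauto
  rw [e, e]

/-- `capH 1 0 + capH 0 1` is the pattern with one copy split -/
lemma capH_one_zero_add (O₁ Y₁ : Finset E₁) (hY1 : p₁ ∉ Y₁) (i j : ℕ) :
    capH A₁ p₁ p₂ O₁ Y₁ i j 1 0 + capH A₁ p₁ p₂ O₁ Y₁ i j 0 1 = absH A₁ O₁ (insert p₁ Y₁) i j := by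
  unfold absH
  rw [card_filter_powerset_insert hY1]
  unfold capH pinK
  simp only [cp, Finset.union_empty]
  congr 1
  · congr 1
    ext γ₁
    rw [Finset.mem_filter, Finset.mem_filter]
    apply and_congr_right
    intro hγ₁
    rw [Finset.mem_powerset] at hγ₁
    rw [insert_sdiff_of_not_mem' hγ₁ hY1, union_union_singleton_eq']
  · congr 1
    ext γ₁
    rw [Finset.mem_filter, Finset.mem_filter]
    apply and_congr_right
    intro _
    rw [insert_sdiff_insert' hY1, union_union_singleton_eq']

/-- `capH 2 1 + capH 1 2` is the pattern with one copy pinned and the other split -/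
lemma capH_two_one_add (O₁ Y₁ : Finset E₁) (hY2 : p₂ ∉ Y₁) (i j : ℕ) :
    capH A₁ p₁ p₂ O₁ Y₁ i j 2 1 + capH A₁ p₁ p₂ O₁ Y₁ i j 1 2
      = absH A₁ (insert p₁ O₁) (insert p₂ Y₁) i j := by
  unfold absH
  rw [card_filter_powerset_insert hY2]
  unfold capH pinK
  simp only [cp]
  have e2 : ∀ S : Finset E₁, O₁ ∪ S ∪ {p₁, p₂} = insert p₁ O₁ ∪ insert p₂ S := by
    intro S; ext x
    simp only [Finset.mem_union, Finset.mem_insert, Finset.mem_singleton]; tauto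
  congr 1
  · congr 1
    ext γ₁
    rw [Finset.mem_filter, Finset.mem_filter]
    apply and_congr_right
    intro hγ₁
    rw [Finset.mem_powerset] at hγ₁
    rw [insert_sdiff_of_not_mem' hγ₁ hY2, e2, union_union_singleton_eq]
  · congr 1
    ext γ₁
    rw [Finset.mem_filter, Finset.mem_filter]
    apply and_congr_right
    intro _
    rw [insert_sdiff_insert' hY2, e2, union_union_singleton_eq]

/-- `capH 2 0 + capH 0 2 + 2·capH 1 1` is the pattern with both copies split (the two mixed
colourings of the pair are the pinned pattern, by the swap) -/
lemma capH_two_add_two (hpar : IsParallel A₁ p₁ p₂) (O₁ Y₁ : Finset E₁) (hO1 : p₁ ∉ O₁)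
    (hO2 : p₂ ∉ O₁) (hY1 : p₁ ∉ Y₁) (hY2 : p₂ ∉ Y₁) (i j : ℕ) :
    capH A₁ p₁ p₂ O₁ Y₁ i j 2 0 + capH A₁ p₁ p₂ O₁ Y₁ i j 0 2 + 2 * capH A₁ p₁ p₂ O₁ Y₁ i j 1 1
      = absH A₁ O₁ (insert p₁ (insert p₂ Y₁)) i j := by
  have hY1' : p₁ ∉ insert p₂ Y₁ := by
    rw [Finset.mem_insert, not_or]; exact ⟨hpar.ne, hY1⟩
  unfold absH
  rw [card_filter_powerset_insert hY1', card_filter_powerset_insert hY2,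
    card_filter_powerset_insert hY2]
  unfold capH pinK
  simp only [cp, Finset.union_empty]
  -- the four colourings of the pair
  have hsw : ∀ (S : Finset E₁) (k : ℕ), p₁ ∉ S → p₂ ∉ S →
      (kDisj A₁ k (S ∪ {p₂}) ↔ kDisj A₁ k (S ∪ {p₁})) := by
    intro S k h1 h2
    rw [union_singleton_eq_insert, union_singleton_eq_insert]
    exact kDisj_insert_swap hpar k h1 h2
  have hOγ : ∀ γ₁ ⊆ Y₁, p₁ ∉ O₁ ∪ γ₁ ∧ p₂ ∉ O₁ ∪ γ₁ := by
    intro γ₁ hγ₁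
    rw [Finset.mem_union, Finset.mem_union, not_or, not_or]
    exact ⟨⟨hO1, fun h => hY1 (hγ₁ h)⟩, ⟨hO2, fun h => hY2 (hγ₁ h)⟩⟩
  have hOd : ∀ γ₁ : Finset E₁, p₁ ∉ O₁ ∪ (Y₁ \ γ₁) ∧ p₂ ∉ O₁ ∪ (Y₁ \ γ₁) := by
    intro γ₁
    rw [Finset.mem_union, Finset.mem_union, not_or, not_or]
    exact ⟨⟨hO1, fun h => hY1 (Finset.mem_sdiff.mp h).1⟩, ⟨hO2, fun h => hY2 (Finset.mem_sdiff.mp h).1⟩⟩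
  -- term by term: (no copy blue) = both red; (p₂ blue) = mixed; (p₁ blue) = mixed; (both blue)
  have t1 : (Y₁.powerset.filter (fun S => kDisj A₁ i (O₁ ∪ (insert p₁ (insert p₂ Y₁) \ S)) ∧
      ¬ kDisj A₁ (i + 1) (O₁ ∪ (insert p₁ (insert p₂ Y₁) \ S)) ∧ kDisj A₁ j (O₁ ∪ S))).card
      = (Y₁.powerset.filter (fun γ₁ => kDisj A₁ i (O₁ ∪ (Y₁ \ γ₁) ∪ {p₁, p₂}) ∧
          ¬ kDisj A₁ (i + 1) (O₁ ∪ (Y₁ \ γ₁) ∪ {p₁, p₂}) ∧ kDisj A₁ j (O₁ ∪ γ₁))).card := by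
    congr 1; ext γ₁
    rw [Finset.mem_filter, Finset.mem_filter]
    apply and_congr_right
    intro hγ₁
    rw [Finset.mem_powerset] at hγ₁
    have hγ₁' : γ₁ ⊆ insert p₂ Y₁ := hγ₁.trans (Finset.subset_insert _ _)
    rw [insert_sdiff_of_not_mem' hγ₁' hY1', insert_sdiff_of_not_mem' hγ₁ hY2]
    have e : O₁ ∪ insert p₁ (insert p₂ (Y₁ \ γ₁)) = O₁ ∪ (Y₁ \ γ₁) ∪ {p₁, p₂} := by
      ext x; simp only [Finset.mem_union, Finset.mem_insert, Finset.mem_singleton]; tauto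
    rw [e]
  have t2 : (Y₁.powerset.filter (fun S => kDisj A₁ i (O₁ ∪ (insert p₁ (insert p₂ Y₁) \ insert p₂ S)) ∧
      ¬ kDisj A₁ (i + 1) (O₁ ∪ (insert p₁ (insert p₂ Y₁) \ insert p₂ S)) ∧ kDisj A₁ j (O₁ ∪ insert p₂ S))).card
      = (Y₁.powerset.filter (fun γ₁ => kDisj A₁ i (O₁ ∪ (Y₁ \ γ₁) ∪ {p₁}) ∧
          ¬ kDisj A₁ (i + 1) (O₁ ∪ (Y₁ \ γ₁) ∪ {p₁}) ∧ kDisj A₁ j (O₁ ∪ γ₁ ∪ {p₁}))).card := by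
    congr 1; ext γ₁
    rw [Finset.mem_filter, Finset.mem_filter]
    apply and_congr_right
    intro hγ₁
    rw [Finset.mem_powerset] at hγ₁
    have hγ₁' : insert p₂ γ₁ ⊆ insert p₂ Y₁ := Finset.insert_subset_insert _ hγ₁
    rw [insert_sdiff_of_not_mem' hγ₁' hY1', insert_sdiff_insert' hY2]
    have e : O₁ ∪ insert p₁ (Y₁ \ γ₁) = O₁ ∪ (Y₁ \ γ₁) ∪ {p₁} := by
      ext x; simp only [Finset.mem_union, Finset.mem_insert, Finset.mem_singleton]; tauto
    have e' : O₁ ∪ insert p₂ γ₁ = O₁ ∪ γ₁ ∪ {p₂} := by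
      ext x; simp only [Finset.mem_union, Finset.mem_insert, Finset.mem_singleton]; tauto
    rw [e, e', hsw _ _ (hOγ γ₁ hγ₁).1 (hOγ γ₁ hγ₁).2]
  have t3 : (Y₁.powerset.filter (fun S => kDisj A₁ i (O₁ ∪ (insert p₁ (insert p₂ Y₁) \ insert p₁ S)) ∧
      ¬ kDisj A₁ (i + 1) (O₁ ∪ (insert p₁ (insert p₂ Y₁) \ insert p₁ S)) ∧ kDisj A₁ j (O₁ ∪ insert p₁ S))).card
      = (Y₁.powerset.filter (fun γ₁ => kDisj A₁ i (O₁ ∪ (Y₁ \ γ₁) ∪ {p₁}) ∧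
          ¬ kDisj A₁ (i + 1) (O₁ ∪ (Y₁ \ γ₁) ∪ {p₁}) ∧ kDisj A₁ j (O₁ ∪ γ₁ ∪ {p₁}))).card := by
    congr 1; ext γ₁
    rw [Finset.mem_filter, Finset.mem_filter]
    apply and_congr_right
    intro hγ₁
    rw [Finset.mem_powerset] at hγ₁
    rw [insert_sdiff_insert' hY1', insert_sdiff_of_not_mem' hγ₁ hY2]
    have e : O₁ ∪ insert p₂ (Y₁ \ γ₁) = O₁ ∪ (Y₁ \ γ₁) ∪ {p₂} := by
      ext x; simp only [Finset.mem_union, Finset.mem_insert, Finset.mem_singleton]; tauto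
    have e' : O₁ ∪ insert p₁ γ₁ = O₁ ∪ γ₁ ∪ {p₁} := by
      ext x; simp only [Finset.mem_union, Finset.mem_insert, Finset.mem_singleton]; tauto
    rw [e, e', hsw _ _ (hOd γ₁).1 (hOd γ₁).2, hsw _ _ (hOd γ₁).1 (hOd γ₁).2]
  have t4 : (Y₁.powerset.filter (fun S => kDisj A₁ i (O₁ ∪ (insert p₁ (insert p₂ Y₁) \ insert p₁ (insert p₂ S))) ∧
      ¬ kDisj A₁ (i + 1) (O₁ ∪ (insert p₁ (insert p₂ Y₁) \ insert p₁ (insert p₂ S))) ∧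
      kDisj A₁ j (O₁ ∪ insert p₁ (insert p₂ S)))).card
      = (Y₁.powerset.filter (fun γ₁ => kDisj A₁ i (O₁ ∪ (Y₁ \ γ₁)) ∧
          ¬ kDisj A₁ (i + 1) (O₁ ∪ (Y₁ \ γ₁)) ∧ kDisj A₁ j (O₁ ∪ γ₁ ∪ {p₁, p₂}))).card := by
    congr 1; ext γ₁
    rw [Finset.mem_filter, Finset.mem_filter]
    apply and_congr_right
    intro _
    rw [insert_sdiff_insert' hY1', insert_sdiff_insert' hY2]
    have e : O₁ ∪ insert p₁ (insert p₂ γ₁) = O₁ ∪ γ₁ ∪ {p₁, p₂} := by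
      ext x; simp only [Finset.mem_union, Finset.mem_insert, Finset.mem_singleton]; tauto
    rw [e]
  rw [t1, t2, t3, t4]
  ring

end Identities

end StepZero

end Summit.Ventures.PercRepro2
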